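import Literature.IUT.HodgeTheaters.GlobalFrobenioidsFcircVerticalAutInvariant
import Literature.IUT.HodgeTheaters.GlobalFrobenioidsPushCarrierGaloisRich
import Literature.IUT.HodgeTheaters.Cor53iFcircHdescOfAutDescendsModInner
import Literature.AlgebraicGeometry.Frobenioids.ArithmeticDivisorsUnits
import Mathlib.RingTheory.Polynomial.Cyclotomic.Roots
import Mathlib.FieldTheory.Minpoly.Finite
import HarnessLib

/-!
# [IUTchI] Cor 5.3 (i) «resp. ⊚»: `hlift⊚` is FALSE at the push carrier of `pr₁ : G_F × G_F ↠ G_F` — lifting, too, is carrier-sensitive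

S. Mochizuki, *Inter-universal Teichmüller theory I*, kurims manuscript (May 2020), §5 Cor 5.3 (i) p. 144 l. 2–11 («the natural map
`Isom(¹ℱ^⊚, ²ℱ^⊚) → Isom(Base(¹ℱ^⊚), Base(²ℱ^⊚))` is bijective»); Example 5.1 (i) p. 123 (`†𝒟^⊚ → †𝒟^⊛` from the OPEN INJECTION
`π₁(†𝒟^⊚) ↪ π₁(†𝒟^⊛)`), (iii) pp. 125–126 (`†ℱ^⊚ := †ℱ^⊛|_{†𝒟^⊚}`) ([IUTchI] Cor 5.3 (i) p.144) [claim: Mochizuki2012, status: disputed]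
(D-0012 claim key; nothing of the series is asserted; no side taken on [IUTchIII] Cor. 3.12).  [FrdI] Ex 6.3 p. 113 «`O^×(A) = O^▷(A) =
μ(L)`» [cite: MochizukiFrdI2008, Ex. 6.3 p.113]; [FrdII] Ex 1.3 (ii) p. 11 (`φ_*`) [cite: MochizukiFrdII2008, Ex 1.3 (ii) p.11].

PROOF-ONLY NV file (cell abc-iut, seat abc-iut-L5-t4 gen 12, row «HLIFT⊚-FALSE@PR1», abc-iut-L5-lead RULINGS #238; 0 def · 0 instance ·
no Prop fact): the LIFTING twin of ★ `Cor53iFcircHdescNotAtFstCarrier` (t4 g10: `hdesc⊚` fails at `pr₁`) and the non-injective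
counterpart of abc-iut-L5-t11's ★ `Cor53iFcircLiftsAllAtOpenEmbedding` (lifting SIDE-FREE at open EMBEDDINGS).  At the LITERAL push
carrier `H := G_F × G_F`, `ι := pr₁` of ★ `GlobalFrobenioidsPushCarrierGaloisRich` §4 (a continuous open SURJECTION) and the arithmetic
divisor data `GlobalDivisorData.arith F`, for EVERY record `𝓕` and EVERY number field `F`:
* `Cor53.not_liftsAll_fcircBase_fstPushCarrier` — the (k2) binder `hlift⊚` of ★ `Cor53.fcirc_descendBijective_of_kernel_trivial_of_lifts`
  (`Cor53TelescopeCensusKnit.lean` l. 151–152: `∀ Θ : BaseCat H ≌ BaseCat H, ∃ Ψ : 𝓕.Fcirc ≌ 𝓕.Fcirc, Nonempty (LiesUnder 𝓕.fcircBase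
  𝓕.fcircBase Ψ Θ)`) is FALSE;
* `Cor53.not_fcirc_descendBijective_fstPushCarrier` — hence [IUTchI] Cor 5.3 (i) «resp. ⊚» AS TYPED («bijective», for ANY existence /
  uniqueness binders `he`, `hu` of the natural map) FAILS at that carrier (surjectivity fails).
MECHANISM (`GlobalFrobenioidsFcircVerticalAutInvariant.lean`): «`Y ∈ †ℱ^⊚` has a VERTICAL automorphism `a ≠ id` with `aᵖ = id`» moves
forward along any `Ψ` lying over any `Θ`; at the arithmetic model it says that the number field of the base object `toBase0(α₁ D)` under
`Y` contains a primitive `p`-th root of unity ([FrdI] Def 1.2 (ii) `O^×(A) ↪ 𝔹(A) = L^×`, Ex 6.3 `O^×(A) = μ(L)`).  With `Θ := α₁ ≫ swap^*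
≫ α₁⁻¹`, a record object over `(G×G)/(V×G)` (base `G/V`, field `F̄^V = F(ζ_p)`, `p` prime, `[F:ℚ] + 1 < p`) would go to one over
`(G×G)/(G×V)` (base `G/G`, field `F`, which has NO primitive `p`-th root: `deg Φ_p = p − 1 > [F:ℚ]`).  HONEST LABEL: OUR stand-in carrier;
print's carrier class is open INJECTIONS ([IUTchI] Ex 5.1 (i) p.123); this shows the descent input of abc-iut-w4-d109's ★
`liftsAll_fcircBase_arith_of_desc_of_neukirchUchida` is load-bearing off the embedding class; refutable-as-typed at the stand-in ≠ refuted in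
print; no side on [IUTchIII] Cor 3.12; not an abc claim. -/

noncomputable section

namespace Literature.IUT.HodgeTheaters

open CategoryTheory Opposite Function Literature.AlgebraicGeometry.Frobenioids Literature.AnabelianGeometry.SemiGraphs
open Literature.AlgebraicGeometry.Frobenioids.QuasiTemperoid

/-! ### §1 Cyclotomic input: a prime `p > [F:ℚ] + 1`, so `F` has no primitive `p`-th root of unity while `F̄` has one -/

section Cyclotomic
variable (F : Type) [Field F] [NumberField F]

/-- **No primitive `p`-th root of unity in `F` for a prime `p` with `[F:ℚ] + 1 < p`**: its minimal polynomial over `ℚ` would be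
`Φ_p` (Mathlib `Polynomial.cyclotomic_eq_minpoly_rat`), of degree `p − 1 > [F:ℚ]`. [cite: MochizukiFrdI2008, Ex. 6.3 p.113] -/
theorem not_isPrimitiveRoot_of_finrank_lt {p : ℕ} (hp : p.Prime) (hpF : Module.finrank ℚ F + 1 < p) (y : F) :
    ¬ IsPrimitiveRoot y p := by
  intro hy
  have h1 := minpoly.natDegree_le (A := ℚ) y
  rw [← Polynomial.cyclotomic_eq_minpoly_rat hy hp.pos, Polynomial.natDegree_cyclotomic, Nat.totient_prime hp] at h1
  omega

/-- **… hence none in the bottom field `F̄^{G_F} = F` of `F̄/F`** (Mathlib `InfiniteGalois.fixedField_bot`, `IntermediateField.mem_bot`).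
[cite: MochizukiFrdI2008, Ex. 6.3 p.113] -/
theorem not_isPrimitiveRoot_of_mem_fixedField_top {p : ℕ} (hp : p.Prime) (hpF : Module.finrank ℚ F + 1 < p) {x : Fbar F}
    (hx : x ∈ IntermediateField.fixedField (⊤ : Subgroup (GalFbar F))) : ¬ IsPrimitiveRoot x p := by
  haveI : IsGalois F (Fbar F) := isGalois_fbar F
  rw [InfiniteGalois.fixedField_bot, IntermediateField.mem_bot] at hx
  obtain ⟨y, rfl⟩ := hx
  intro hx
  exact not_isPrimitiveRoot_of_finrank_lt F hp hpF y (hx.of_map_of_injective (algebraMap F (Fbar F)).injective)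

/-- **A prime `p` with `[F:ℚ] + 1 < p`, a primitive `p`-th root of unity `ζ ∈ F̄`, and the OPEN subgroup `V := Gal(F̄/F(ζ))` whose fixed
field `F̄^V = F(ζ)` contains `ζ`** (Mathlib: `Nat.exists_infinite_primes`, `IsAlgClosed.exists_root` on `Φ_p`, `Polynomial.isRoot_cyclotomic_iff`,
`InfiniteGalois.fixedField_fixingSubgroup`). [cite: MochizukiFrdI2008, Ex. 6.3 p.113] -/
theorem exists_prime_openSubgroup_primitiveRoot :
    ∃ (p : ℕ) (V : OpenSubgroup (GalFbar F)) (ζ : Fbar F), p.Prime ∧ Module.finrank ℚ F + 1 < p ∧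
      ζ ∈ IntermediateField.fixedField (V : Subgroup (GalFbar F)) ∧ IsPrimitiveRoot ζ p := by
  haveI : IsGalois F (Fbar F) := isGalois_fbar F
  obtain ⟨p, hple, hp⟩ := Nat.exists_infinite_primes (Module.finrank ℚ F + 2)
  haveI : NeZero p := ⟨hp.ne_zero⟩
  obtain ⟨ζ, hζ⟩ := IsAlgClosed.exists_root (Polynomial.cyclotomic p (Fbar F))
    (Polynomial.degree_cyclotomic_pos p (Fbar F) hp.pos).ne'
  rw [Polynomial.isRoot_cyclotomic_iff] at hζ
  -- `K := F(ζ)`, finite over `F` (`ζ` is integral: `ζ ^ p = 1`)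
  have hint : IsIntegral F ζ := IsIntegral.of_pow hp.pos (by rw [hζ.pow_eq_one]; exact isIntegral_one)
  haveI : FiniteDimensional F (IntermediateField.adjoin F {ζ}) := IntermediateField.adjoin.finiteDimensional hint
  refine ⟨p, ⟨(IntermediateField.adjoin F {ζ}).fixingSubgroup, (IntermediateField.adjoin F {ζ}).fixingSubgroup_isOpen⟩, ζ, hp,
    by omega, ?_, hζ⟩
  change ζ ∈ IntermediateField.fixedField (IntermediateField.adjoin F {ζ}).fixingSubgroup
  rw [InfiniteGalois.fixedField_fixingSubgroup]
  exact IntermediateField.mem_adjoin_simple_self F ζ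
end Cyclotomic

/-! ### §2 At the arithmetic model: vertical `p`-torsion of `ℱ^⊛(†𝒟^⊚)` over `A` = primitive `p`-th roots of unity in the number field of `A` -/

section Arith
variable (F : Type) [Field F] [NumberField F]

/-- **`u ∈ 𝔹(A) = L_A^×` with `uᵖ = 1`, `u ≠ 1` (`p` prime) is a primitive `p`-th root of unity of `F̄` lying in `L_A`** (the number
field `F̄^{Stab(a_A)}` «corresponding to `A`», [IUTchI] Ex 5.1 (ii)). [cite: MochizukiFrdI2008, Ex. 6.3 p.113] [claim: Mochizuki2012, status: disputed] -/
theorem arith_exists_mem_isPrimitiveRoot_of_unit (A : BaseCat (absGalGrp F)) {p : ℕ} (hp : p.Prime)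
    (h : ∃ u : (GlobalDivisorData.arith F).B.obj (op A), u ^ p = 1 ∧ u ≠ 1) :
    ∃ x : Fbar F, x ∈ ((galoisSubextOfFinite F).obj A).L ∧ IsPrimitiveRoot x p := by
  obtain ⟨u, hup, hu1⟩ := h
  change (((galoisSubextOfFinite F).obj A).L)ˣ at u
  have hord : orderOf u = p :=
    (hp.eq_one_or_self_of_dvd _ (orderOf_dvd_of_pow_eq_one hup)).resolve_left (by rwa [orderOf_eq_one_iff])
  have hprim : IsPrimitiveRoot u p := hord ▸ IsPrimitiveRoot.orderOf u
  refine ⟨((u : ((galoisSubextOfFinite F).obj A).L) : Fbar F), (u : ((galoisSubextOfFinite F).obj A).L).2, ?_⟩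
  exact IsPrimitiveRoot.coe_submonoidClass_iff.mpr (IsPrimitiveRoot.coe_units_iff.mpr hprim)

/-- **Conversely, a primitive `p`-th root of unity `x ∈ L_A` (`p` prime) is an element `u ∈ 𝔹(A)` with `uᵖ = 1`, `u ≠ 1` AND `Div_B u = 0`**
(abc-iut-L1's ★ `principalArithDivisor_eq_zero_iff`: roots of unity have zero arithmetic divisor, [FrdI] Ex 6.3 «`O^×(A) = μ(L)`»).
[cite: MochizukiFrdI2008, Ex. 6.3 p.113] [claim: Mochizuki2012, status: disputed] -/
theorem arith_exists_unit_div_of_mem_isPrimitiveRoot (A : BaseCat (absGalGrp F)) {p : ℕ} (hp : p.Prime) {x : Fbar F}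
    (hx : x ∈ ((galoisSubextOfFinite F).obj A).L) (hxp : IsPrimitiveRoot x p) :
    ∃ u : (GlobalDivisorData.arith F).B.obj (op A),
      divB (GlobalDivisorData.arith F).Φ (GlobalDivisorData.arith F).B (GlobalDivisorData.arith F).div (op A) u = 1 ∧
        u ^ p = 1 ∧ u ≠ 1 := by
  have hx' : IsPrimitiveRoot (⟨x, hx⟩ : ((galoisSubextOfFinite F).obj A).L) p :=
    IsPrimitiveRoot.coe_submonoidClass_iff.mp hxp
  obtain ⟨u, hu⟩ := hx'.isUnit hp.ne_zero
  have hup' : IsPrimitiveRoot u p := IsPrimitiveRoot.coe_units_iff.mp (hu ▸ hx')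
  have hup : u ^ p = 1 := hup'.pow_eq_one
  refine ⟨u, ?_, hup, hup'.ne_one hp.one_lt⟩
  -- `Div_B u = div(u) = 0` since `u` has finite order
  have hfin : IsOfFinOrder u := isOfFinOrder_iff_pow_eq_one.mpr ⟨p, hp.pos, hup⟩
  have h0 := (principalArithDivisor_eq_zero_iff u).mpr hfin
  change (EffArithDivisor.gpEquiv _).symm (principalArithDivisorHom _ u) = 1
  have h1 : principalArithDivisorHom _ u = 1 := by
    change Multiplicative.ofAdd (principalArithDivisor _ u) = 1
    rw [h0, ofAdd_zero]
  rw [h1, map_one]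

/-- **Primitive `p`-th roots move along arrows of `†𝒟^⊛`** (`g : A → A'` induces an `F`-embedding `L_{A'} → L_A`, `a ↦ σ a`).
([IUTchI] Ex 5.1 (ii) p.125) [cite: MochizukiFrdI2008, Ex. 6.3 p.113] [claim: Mochizuki2012, status: disputed] -/
theorem arith_exists_mem_isPrimitiveRoot_of_hom {A A' : BaseCat (absGalGrp F)} (g : A ⟶ A') {p : ℕ}
    (h : ∃ x : Fbar F, x ∈ ((galoisSubextOfFinite F).obj A').L ∧ IsPrimitiveRoot x p) :
    ∃ x : Fbar F, x ∈ ((galoisSubextOfFinite F).obj A).L ∧ IsPrimitiveRoot x p := by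
  obtain ⟨x, hx, hxp⟩ := h
  let φ := ((galoisSubextOfFinite F).map g).toAlgHom
  refine ⟨((φ ⟨x, hx⟩ : ((galoisSubextOfFinite F).obj A).L) : Fbar F), (φ ⟨x, hx⟩).2, ?_⟩
  exact IsPrimitiveRoot.coe_submonoidClass_iff.mpr
    ((IsPrimitiveRoot.coe_submonoidClass_iff.mp hxp : IsPrimitiveRoot (⟨x, hx⟩ : ((galoisSubextOfFinite F).obj A').L) p).map_of_injective
      φ.toRingHom.injective)

/-- **The number field of the object `G_F/V` is `F̄^V`, up to an `F`-isomorphism** (abc-iut-L5-t4 g9's ★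
`nonempty_toConnected_galoisSubext_iso_cosetFixedSubext`): primitive `p`-th roots in `L_{cosetToBase(G_F/V)}` ⟺ in `F̄^V`.
([IUTchI] Ex 5.1 (i) p.123) [cite: MochizukiFrdI2008, Ex. 6.3 p.113] [claim: Mochizuki2012, status: disputed] -/
theorem arith_exists_mem_isPrimitiveRoot_cosetToBase_iff (X : CosetCat (GalFbar F)) (p : ℕ) :
    (∃ x : Fbar F, x ∈ ((galoisSubextOfFinite F).obj ((cosetToBase (absGalGrp F)).obj X)).L ∧ IsPrimitiveRoot x p) ↔
      ∃ x : Fbar F, x ∈ IntermediateField.fixedField (X.sg : Subgroup (GalFbar F)) ∧ IsPrimitiveRoot x p := by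
  haveI : IsGalois F (Fbar F) := isGalois_fbar F
  haveI := BCat.connectedToBTemp_isEquivalence (absGalGrp F)
  have hT : IsTempered (GalFbar F) := IsTempered.of_profinite
  obtain ⟨e₂⟩ := nonempty_toConnected_galoisSubext_iso_cosetFixedSubext F hT
  -- `Spec L_{cosetToBase X} ≅ Spec F̄^X` in `FinSubextCat`
  let j : (galoisSubextOfFinite F).obj ((cosetToBase (absGalGrp F)).obj X) ≅ (cosetFixedSubext F).obj X :=
    (galoisSubext F).mapIso ((BCat.connectedToBTemp (absGalGrp F)).asEquivalence.counitIso.app ((CosetCat.toConnected hT).obj X)) ≪≫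
      e₂.app X
  constructor
  · rintro ⟨x, hx, hxp⟩
    let y := j.inv.toAlgHom ⟨x, hx⟩
    refine ⟨(y : Fbar F), y.2, IsPrimitiveRoot.coe_submonoidClass_iff.mpr ?_⟩
    exact (IsPrimitiveRoot.coe_submonoidClass_iff.mp hxp :
      IsPrimitiveRoot (⟨x, hx⟩ : ((galoisSubextOfFinite F).obj ((cosetToBase (absGalGrp F)).obj X)).L) p).map_of_injective
        j.inv.toAlgHom.toRingHom.injective
  · rintro ⟨x, hx, hxp⟩
    let y := j.hom.toAlgHom ⟨x, hx⟩
    refine ⟨(y : Fbar F), y.2, IsPrimitiveRoot.coe_submonoidClass_iff.mpr ?_⟩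
    exact (IsPrimitiveRoot.coe_submonoidClass_iff.mp hxp :
      IsPrimitiveRoot (⟨x, hx⟩ : ((cosetFixedSubext F).obj X).L) p).map_of_injective j.hom.toAlgHom.toRingHom.injective
end Arith

/-! ### §3 [IUTchI] Cor 5.3 (i) «resp. ⊚» at the `pr₁` push carrier: `hlift⊚` FAILS; «bijective» FAILS -/

section Headline
variable (F : Type) [Field F] [NumberField F]

/-- **`hlift⊚` REFUTED AS TYPED at the `pr₁` push carrier `ℬ(G_F × G_F)⁰ ⥤ ℬ(G_F)⁰`** (literal carrier of ★ `Cor53.not_hdesc_fstPushCarrier`: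
`H := G_F × G_F`, `ι := pr₁`, a continuous open SURJECTION; `Δ :=` the arithmetic divisor data `GlobalDivisorData.arith F`): for EVERY record
`𝓕` ([IUTchI] Ex 5.1 (iii)) and EVERY number field `F`, NOT every self-equivalence `Θ` of `†𝒟^⊚` has a self-equivalence of `†ℱ^⊚` lying over
it — the (k2) binder `hlift⊚` of ★ `Cor53.fcirc_descendBijective_of_kernel_trivial_of_lifts` (`Cor53TelescopeCensusKnit.lean` l. 151–152)
VERBATIM, negated.  Witness: `Θ := α₁ ≫ swap^* ≫ α₁⁻¹`; a record object over `(G×G)/(V×G)`, `V = Gal(F̄/F(ζ_p))`, `p` prime `> [F:ℚ]+1`,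
carries a vertical automorphism of order `p` (the unit `ζ_p ∈ 𝔹 = F(ζ_p)^×`, `Div_B ζ_p = 0`), its would-be image over `(G×G)/(G×V)`
(base `G/G`, field `F`) cannot.  OUR stand-in carrier; print's `†𝒟^⊚ → †𝒟^⊛` is the open INJECTION `π₁(C_K) ↪ π₁(C_{F_mod})`
([IUTchI] Ex 5.1 (i) p.123), where lifting is side-free (abc-iut-L5-t11 ★ `liftsAll_fcircBase_arith_of_openEmbedding_of_neukirchUchida`);
so the DESCENT input `hdesc` of abc-iut-w4-d109's ★ `liftsAll_fcircBase_arith_of_desc_of_neukirchUchida` is load-bearing off the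
embedding class.  No side on [IUTchIII] Cor 3.12; not an abc claim. ([IUTchI] Cor 5.3 (i) p.144) [cite: MochizukiFrdI2008, Ex. 6.3 p.113]
[claim: Mochizuki2012, status: disputed] -/
theorem Cor53.not_liftsAll_fcircBase_fstPushCarrier
    (𝓕 : GlobalFrobenioid (GlobalDivisorData.arith F) (BaseCat (ProfiniteGrp.of (absGalGrp F × absGalGrp F)))
      (baseToCoset (ProfiniteGrp.of (absGalGrp F × absGalGrp F)) ⋙
        CosetCat.push (MonoidHom.fst (absGalGrp F) (absGalGrp F)) isOpenMap_fst ⋙ cosetToBase (absGalGrp F))) :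
    ¬ ∀ Θ : BaseCat (ProfiniteGrp.of (absGalGrp F × absGalGrp F)) ≌ BaseCat (ProfiniteGrp.of (absGalGrp F × absGalGrp F)),
        ∃ Ψ : 𝓕.Fcirc ≌ 𝓕.Fcirc, Nonempty (CatIsomorphism.LiesUnder 𝓕.fcircBase 𝓕.fcircBase Ψ Θ) := by
  intro hlift
  haveI : IsGalois F (Fbar F) := isGalois_fbar F
  haveI := BCat.connectedToBTemp_isEquivalence (ProfiniteGrp.of (absGalGrp F × absGalGrp F))
  haveI := BCat.connectedToBTemp_isEquivalence (absGalGrp F)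
  haveI := CosetCat.toConnected_isEquivalence (IsTempered.of_profinite (G := ProfiniteGrp.of (absGalGrp F × absGalGrp F)))
  -- (1) the cyclotomic input: `p`, `V = Gal(F̄/F(ζ_p))`, `ζ_p ∈ F̄^V`
  obtain ⟨p, V, ζ, hp, hpF, hζV, hζ⟩ := exists_prime_openSubgroup_primitiveRoot F
  -- (2) the factor swap of `G_F × G_F`, transported to `ℬ(G_F × G_F)⁰`, conjugated by `α₁`
  let ψ : (absGalGrp F × absGalGrp F) ≃ₜ* (absGalGrp F × absGalGrp F) :=
    { MulEquiv.prodComm with continuous_toFun := continuous_swap, continuous_invFun := continuous_swap }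
  have hψ : ∀ x : absGalGrp F × absGalGrp F, ψ x = x.swap := fun _ => rfl
  haveI := CosetCat.pull_isEquivalence_of_continuousMulEquiv ψ
  let πψ := CosetCat.pull ψ.toMonoidHom ψ.continuous ψ.surjective
  let eB := (cosetToBase (ProfiniteGrp.of (absGalGrp F × absGalGrp F))).asEquivalence
  let σ : BaseCat (ProfiniteGrp.of (absGalGrp F × absGalGrp F)) ≌ BaseCat (ProfiniteGrp.of (absGalGrp F × absGalGrp F)) :=
    eB.symm.trans (πψ.asEquivalence.trans eB)
  let X₀ : CosetCat (ProfiniteGrp.of (absGalGrp F × absGalGrp F)) := ⟨V.prod ⊤⟩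
  let E₀ : BaseCat (ProfiniteGrp.of (absGalGrp F × absGalGrp F)) :=
    (cosetToBase (ProfiniteGrp.of (absGalGrp F × absGalGrp F))).obj X₀
  let D : BaseCat (ProfiniteGrp.of (absGalGrp F × absGalGrp F)) := 𝓕.α₁.inverse.obj E₀
  let Θ : BaseCat (ProfiniteGrp.of (absGalGrp F × absGalGrp F)) ≌ BaseCat (ProfiniteGrp.of (absGalGrp F × absGalGrp F)) :=
    𝓕.α₁.trans (σ.trans 𝓕.α₁.symm)
  obtain ⟨Ψ, ⟨hΨ⟩⟩ := hlift Θ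
  -- abbreviation: the structure functor `toBase0 = bridge ⋙ (pr₁)_* ⋙ bridge`
  let T₀ : BaseCat (ProfiniteGrp.of (absGalGrp F × absGalGrp F)) ⥤ BaseCat (absGalGrp F) :=
    baseToCoset (ProfiniteGrp.of (absGalGrp F × absGalGrp F)) ⋙
      CosetCat.push (MonoidHom.fst (absGalGrp F) (absGalGrp F)) isOpenMap_fst ⋙ cosetToBase (absGalGrp F)
  -- (3) a record object `Y` of `†ℱ^⊚` over `D`: first component = `equiv⁻¹ (A₀, 0)`, `A₀ := toBase0 (α₁ D)`
  let A₀ : BaseCat (absGalGrp F) := T₀.obj (𝓕.α₁.functor.obj D)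
  let Z₀ : (GlobalDivisorData.arith F).ModelGlobalFrobenioid := ⟨A₀, 1⟩
  let Xc : 𝓕.cat := 𝓕.equiv.inverse.obj Z₀
  let e : 𝓕.toBase.obj Xc ≅ 𝓕.baseMor.obj D :=
    𝓕.identify.functor.preimageIso
      (𝓕.toBase_compat.app Xc ≪≫ (GlobalDivisorData.arith F).modelBase.mapIso (𝓕.equiv.counitIso.app Z₀) ≪≫ 𝓕.compat.app D)
  let Y : 𝓕.Fcirc := ⟨Xc, D, e⟩
  -- (4) the base object under `Y` in the model is `≅ cosetToBase (G_F/V)`, whose field `F̄^V` contains `ζ_p`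
  obtain ⟨i₃⟩ := PushCarrier.nonempty_toBase0_cosetToBase_iso F (ProfiniteGrp.of (absGalGrp F × absGalGrp F))
    (MonoidHom.fst (absGalGrp F) (absGalGrp F)) isOpenMap_fst X₀
  let iA : (𝓕.equiv.functor.obj Xc).base ≅ (cosetToBase (absGalGrp F)).obj ⟨V⟩ :=
    (GlobalDivisorData.arith F).modelBase.mapIso (𝓕.equiv.counitIso.app Z₀) ≪≫
      T₀.mapIso (𝓕.α₁.counitIso.app E₀) ≪≫ i₃ ≪≫
        (cosetToBase (absGalGrp F)).mapIso (eqToIso (CosetCatFst.push_fst_prod_top V))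
  have hA₁ : ∃ u' : (GlobalDivisorData.arith F).B.obj (op ((cosetToBase (absGalGrp F)).obj ⟨V⟩)),
      divB (GlobalDivisorData.arith F).Φ (GlobalDivisorData.arith F).B (GlobalDivisorData.arith F).div _ u' = 1 ∧
        u' ^ p = 1 ∧ u' ≠ 1 := by
    obtain ⟨x, hx, hxp⟩ := (arith_exists_mem_isPrimitiveRoot_cosetToBase_iff F ⟨V⟩ p).mpr ⟨ζ, hζV, hζ⟩
    exact arith_exists_unit_div_of_mem_isPrimitiveRoot F ((cosetToBase (absGalGrp F)).obj ⟨V⟩) hp hx hxp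
  obtain ⟨u, hd, hup, hu1⟩ := ModelVertical.exists_unit_div_of_iso (Φ := (GlobalDivisorData.arith F).Φ)
    (B := (GlobalDivisorData.arith F).B) (DivB := (GlobalDivisorData.arith F).div) iA p hA₁
  have hg : ∃ g : Aut (𝓕.equiv.functor.obj Xc), (GlobalDivisorData.arith F).modelBase.map g.hom = 𝟙 _ ∧ g ^ p = 1 ∧ g ≠ 1 :=
    ModelVertical.exists_aut_of_unit (𝓕.equiv.functor.obj Xc)
      ((GlobalDivisorData.arith_isDivisorial F) (𝓕.equiv.functor.obj Xc).base).isPreDivisorial.isIntegral hp.pos u hd hup hu1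
  have hf : ∃ f : Aut Xc, 𝓕.toBase.map f.hom = 𝟙 _ ∧ f ^ p = 1 ∧ f ≠ 1 := 𝓕.exists_vertTorsion_of_equiv p hg
  have hY : ∃ a : Aut Y, 𝓕.fcircBase.map a.hom = 𝟙 _ ∧ a ^ p = 1 ∧ a ≠ 1 := CFPVertical.exists_of_exists_fst Y p hf
  -- (5) push the vertical automorphism forward along `Ψ` (lying over `Θ`), then down to the model under `Ψ Y`
  have hΨY : ∃ b : Aut (Ψ.functor.obj Y), 𝓕.fcircBase.map b.hom = 𝟙 _ ∧ b ^ p = 1 ∧ b ≠ 1 :=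
    CatIsomorphism.exists_vertTorsion_map Ψ.functor 𝓕.fcircBase 𝓕.fcircBase Θ.functor hΨ p hY
  have h₄ : ∃ f : Aut (Ψ.functor.obj Y).fst, 𝓕.toBase.map f.hom = 𝟙 _ ∧ f ^ p = 1 ∧ f ≠ 1 :=
    CFPVertical.exists_fst_of_exists (Ψ.functor.obj Y) p hΨY
  have h₅ : ∃ g : Aut (𝓕.equiv.functor.obj (Ψ.functor.obj Y).fst),
      (GlobalDivisorData.arith F).modelBase.map g.hom = 𝟙 _ ∧ g ^ p = 1 ∧ g ≠ 1 := 𝓕.exists_vertTorsion_equiv p h₄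
  have h₆ : ∃ u : (GlobalDivisorData.arith F).B.obj (op (𝓕.equiv.functor.obj (Ψ.functor.obj Y).fst).base), u ^ p = 1 ∧ u ≠ 1 :=
    ModelVertical.exists_unit_of_exists_aut (𝓕.equiv.functor.obj (Ψ.functor.obj Y).fst)
      ((GlobalDivisorData.arith_isDivisorial F) (𝓕.equiv.functor.obj (Ψ.functor.obj Y).fst).base).isPreDivisorial.isIntegral p h₅
  -- (6) the base object under `Ψ Y` in the model is `≅ cosetToBase (G_F/G_F)`, whose field `F̄^{G_F} = F` has NO primitive `p`-th root
  obtain ⟨i₇⟩ := PushCarrier.nonempty_toBase0_cosetToBase_iso F (ProfiniteGrp.of (absGalGrp F × absGalGrp F))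
    (MonoidHom.fst (absGalGrp F) (absGalGrp F)) isOpenMap_fst (πψ.obj X₀)
  let kA : (𝓕.equiv.functor.obj (Ψ.functor.obj Y).fst).base ≅ (cosetToBase (absGalGrp F)).obj CosetCat.top :=
    (𝓕.toBase_compat.app (Ψ.functor.obj Y).fst).symm ≪≫ 𝓕.identify.functor.mapIso (Ψ.functor.obj Y).iso ≪≫
      (𝓕.compat.app (Ψ.functor.obj Y).snd).symm ≪≫ (𝓕.α₁.functor ⋙ T₀).mapIso (hΨ.app Y) ≪≫
        T₀.mapIso (𝓕.α₁.counitIso.app (σ.functor.obj (𝓕.α₁.functor.obj D)) ≪≫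
          σ.functor.mapIso (𝓕.α₁.counitIso.app E₀)) ≪≫
          T₀.mapIso ((πψ ⋙ cosetToBase (ProfiniteGrp.of (absGalGrp F × absGalGrp F))).mapIso (eB.unitIso.app X₀).symm) ≪≫
            i₇ ≪≫ (cosetToBase (absGalGrp F)).mapIso (eqToIso (CosetCatFst.push_fst_pull_swap_prod_top V ψ hψ))
  have h₇ : ∃ u : (GlobalDivisorData.arith F).B.obj (op ((cosetToBase (absGalGrp F)).obj CosetCat.top)), u ^ p = 1 ∧ u ≠ 1 :=
    ModelVertical.exists_unit_of_iso (B := (GlobalDivisorData.arith F).B) kA.symm p h₆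
  have h₈ := arith_exists_mem_isPrimitiveRoot_of_unit F ((cosetToBase (absGalGrp F)).obj CosetCat.top) hp h₇
  obtain ⟨x, hx, hxp⟩ := (arith_exists_mem_isPrimitiveRoot_cosetToBase_iff F CosetCat.top p).mp h₈
  exact not_isPrimitiveRoot_of_mem_fixedField_top F hp hpF hx hxp

/-- **[IUTchI] Cor 5.3 (i) «resp. ⊚» («bijective») is FALSE AS TYPED at the `pr₁` push carrier** — for EVERY record `𝓕` over the
arithmetic divisor data and ANY existence/uniqueness binders `he`, `hu` of the §0 natural map `Isom(†ℱ^⊚) → Isom(†𝒟^⊚)` (no slimness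
input): SURJECTIVITY fails (a surjective `descend` would lift `Θ` up to isomorphism, and `LiesUnder` is isomorphism-invariant in `Θ`).
Injectivity DOES hold there (★ `Cor53.fcirc_descend_injective_of_pushCarrier`, `G_F × G_F` slim) — it is the lifting half that breaks off
print's carrier class of open INJECTIONS ([IUTchI] Ex 5.1 (i) p.123).  OUR stand-in carrier; no side on [IUTchIII] Cor 3.12; not an abc
claim. ([IUTchI] Cor 5.3 (i) p.144) [cite: MochizukiFrdI2008, Ex. 6.3 p.113] [claim: Mochizuki2012, status: disputed] -/
theorem Cor53.not_fcirc_descendBijective_fstPushCarrier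
    (𝓕 : GlobalFrobenioid (GlobalDivisorData.arith F) (BaseCat (ProfiniteGrp.of (absGalGrp F × absGalGrp F)))
      (baseToCoset (ProfiniteGrp.of (absGalGrp F × absGalGrp F)) ⋙
        CosetCat.push (MonoidHom.fst (absGalGrp F) (absGalGrp F)) isOpenMap_fst ⋙ cosetToBase (absGalGrp F)))
    (he : CatIsomorphism.HasUnder 𝓕.fcircBase 𝓕.fcircBase) (hu : CatIsomorphism.UnderUnique 𝓕.fcircBase 𝓕.fcircBase) :
    ¬ CatIsomorphism.DescendBijective 𝓕.fcircBase 𝓕.fcircBase he hu := by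
  intro hbij
  refine Cor53.not_liftsAll_fcircBase_fstPushCarrier F 𝓕 fun Θ => ?_
  obtain ⟨c, hc⟩ := hbij.2 (CatIsomorphism.mk Θ)
  obtain ⟨Ψ, rfl⟩ := CatIsomorphism.mk_surjective c
  obtain ⟨Θ', hΘ'⟩ := he Ψ
  rw [CatIsomorphism.descend_mk he hu hΘ'] at hc
  obtain ⟨m⟩ := hΘ'
  obtain ⟨j⟩ := (CatIsomorphism.mk_eq_mk_iff _ _).1 hc
  exact ⟨Ψ, ⟨m.ofIsoLower j⟩⟩

end Headline

end Literature.IUT.HodgeTheaters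

end
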